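import Summits.ValiantsHypothesis.ValiantsHypothesis.Theorems.KPlusLogSqLawTropicalGradedWalkDomDGlue1

/-!
# Dominance glue (type D), part 2: block column, rivals above the intended cell

GRW-lite `K = 4` graded-walk family (census side of the tropical root law, all `m`):
dominance glue for the diagonal states `(w, u, 0)`, `u < w < m`, of the design typed in
`KPlusLogSqLawTropicalGradedWalkDefs`.  The slack of every rival cell against the column
potential `UD` (file `…PotD`) was certified family by family in `…DomD1` – `…DomD13`; the files
`…DomDGlue1` – `…DomDGlue5` dispatch an arbitrary rival `(a, b, l)` to its family and conclude
`IsDominant` for these states via `isDominant_of_scaledPotential`.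

Honest framing: this is a census-side (lower-bound) construction — a quadratic family of
distinct optimal slopes for `TropRootLawAt (n+1) 4`.  It says nothing about `TropicalB` inside
its window and nothing about VP ≠ VNP.
-/

set_option linter.dupNamespace false
set_option autoImplicit false

namespace Summit.ValiantsHypothesis.ValiantsHypothesis.Theorems.LacunarySymmetroidMatrixDescartes.TropicalCensus

namespace GradedWalk

open Summit.ValiantsHypothesis.ValiantsHypothesis.Theorems.MatrixDescartes.Negative

variable (n : ℕ)

/-! ### slack, block column, rival above the intended cell (levels above, up to the diagonal) -/

set_option maxHeartbeats 400000 in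
/-- slack of the type-D certificate: block column `b < w`, rival row `b ≤ a < r_b`. -/
theorem slackD_blk_up (w u : ℕ) (huw : u < w) (hwn : w ≤ n) (a b : Fin (n + 1)) (l : Fin 4)
    (hp : ee n a b l ≠ 0)
    (hbw : (b : ℕ) < w) (hba : (b : ℕ) ≤ (a : ℕ)) (halt : (a : ℕ) < (b : ℕ) + (n + 1 - w)) :
    1 * (thD n w u * (dd n l : ℤ) - vv n a b l) <
      UD n w u a + ((thD n w u * (dd n (lam n w u 0 b) : ℤ) - vv n (rot n w b) b (lam n w u 0 b)) - UD n w u (rot n w b)) := by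
  have hw1 : w ≤ n + 1 := by omega
  have hr := rot_val_blk n hw1 b hbw
  have hlowr : (b : ℕ) < ((rot n w b : Fin (n + 1)) : ℕ) := by rw [hr]; omega
  rw [lam_D n huw, if_neg (not_le.mpr hbw)]
  have hEr : n + 1 + (b : ℕ) - ((b : ℕ) + (n + 1 - w)) = w := by omega
  have hwne : w ≠ n + 1 := by omega
  have hT2 : thD n w u * (dd n 2 : ℤ) - vv n (rot n w b) b 2 = thD n w u * d2 n - (v1 n w b + bB n * tau2lt n w b) := by
    rw [dd_cast_two, vv_lower n hlowr, hr, hEr, vblk_two, tau2_of_ne n hwne]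
  have hT1 : thD n w u * (dd n 1 : ℤ) - vv n (rot n w b) b 1 = thD n w u * d1 n - v1 n w b := by
    rw [dd_cast_one, vv_lower n hlowr, hr, hEr, vblk_one]
  have hUr : UD n w u ((rot n w b : Fin (n + 1)) : ℕ) = gG n * thD n w u * ((((b : ℕ) + (n + 1 - w)) : ℕ) : ℤ) + muD n w u b := by
    rw [hr]; unfold UD; rw [show (b : ℕ) + (n + 1 - w) - (n + 1 - w) = b by omega]
  have hUr' : UD n w u ((rot n w b : Fin (n + 1)) : ℕ) = gG n * thD n w u * (((n + 1 - w + (b : ℕ)) : ℕ) : ℤ) + muD n w u b := by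
    rw [hUr, show (b : ℕ) + (n + 1 - w) = n + 1 - w + (b : ℕ) by omega]
  obtain ⟨k, hk⟩ : ∃ k, (a : ℕ) + k = (b : ℕ) + (n + 1 - w) := ⟨(b : ℕ) + (n + 1 - w) - (a : ℕ), by omega⟩
  have hk1 : 1 ≤ k := by omega
  have hkle : k ≤ (b : ℕ) + (n + 1 - w) := by omega
  have hak : (a : ℕ) = (b : ℕ) + (n + 1 - w) - k := by omega
  have hl0 : l = 0 → (a : ℕ) = (b : ℕ) := by
    intro h0; subst h0
    rcases Nat.eq_or_lt_of_le hba with hab | hab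
    · exact hab.symm
    · exact absurd (ee_lower_zero n hab) hp
  rcases Nat.eq_or_lt_of_le hba with hab | hab
  · -- the diagonal cell (b, b): level m
    have hab' : (a : ℕ) = (b : ℕ) := hab.symm
    have hkm : w + k = n + 1 := by omega
    have hX1 : thD n w u * (dd n 1 : ℤ) - vv n a b 1 = thD n w u * d1 n - v1 n (n + 1) b := by
      rw [dd_cast_one, vv_diag n hab' 1 (by decide), vblk_one]
    -- class lift to class 1 (or the class-0 diagonal cell)
    by_cases hcl : l = 0
    · subst hcl
      have hX0 : thD n w u * (dd n 0 : ℤ) - vv n a b 0 = thD n w u * 0 - 0 := by rw [dd_cast_zero, vv_diag_zero n hab']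
      have hrow : UD n w u a = UD n w u (b : ℕ) := by rw [hab']
      by_cases hu0 : u = 0
      · subst hu0
        rw [if_neg (Nat.not_lt_zero _)]
        rcases Nat.lt_or_ge (n + 1 - w) (b : ℕ) with hblk | hpl
        · obtain ⟨jp, hjp⟩ : ∃ jp, (b : ℕ) = (n + 1 - w) + jp := ⟨(b : ℕ) - (n + 1 - w), by omega⟩
          have hY : UD n w 0 a - UD n w 0 ((rot n w b : Fin (n + 1)) : ℕ) = (gG n * thD n w 0 * ((((n + 1 - w) + (jp)) : ℕ) : ℤ) + SLB0 n w jp) - (gG n * thD n w 0 * ((((n + 1 - w) + ((n + 1 - w) + jp)) : ℕ) : ℤ) + SLB0 n w ((n + 1 - w) + jp)) := by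
            rw [hrow, hUr', hjp, muD_z]; unfold UD; rw [show n + 1 - w + jp - (n + 1 - w) = jp by omega, muD_z]
          have hF := D_dg0_B_zz n w jp (n + 1 - w) (by omega) (by omega) (by omega) (by omega)
          rw [hjp] at hT1
          exact slack_of hF hX0 hT1 hY
        · by_cases hb0 : (b : ℕ) = 0
          · have hY : UD n w 0 a - UD n w 0 ((rot n w b : Fin (n + 1)) : ℕ) = (gG n * thD n w 0 * (((0) : ℕ) : ℤ) + SLB0 n w (0)) - (gG n * thD n w 0 * (((n + 1 - w + (0)) : ℕ) : ℤ) + SLB0 n w (0)) := by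
              rw [hrow, hUr', hb0, muD_z]; unfold UD; rw [Nat.zero_sub, muD_z]
            rw [hb0] at hT1
            exact slack_of (D_dg0_P_z0 n w (by omega) hwn) hX0 hT1 hY
          · have hY : UD n w 0 a - UD n w 0 ((rot n w b : Fin (n + 1)) : ℕ) = gG n * thD n w 0 * (((b : ℕ) : ℕ) : ℤ) - (gG n * thD n w 0 * (((n + 1 - w + (b : ℕ)) : ℕ) : ℤ) + SLB0 n w b) := by
              rw [hrow, hUr', muD_z]; unfold UD; rw [show (b : ℕ) - (n + 1 - w) = 0 by omega, muD_zero]; ring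
            exact slack_of (D_dg0_P_z n w b (by omega) (by omega) (by omega)) hX0 hT1 hY
      · by_cases hbu : (b : ℕ) < u
        · rw [if_pos hbu]
          rcases Nat.lt_or_ge (n + 1 - w) (b : ℕ) with hblk | hpl
          · obtain ⟨jp, hjp⟩ : ∃ jp, (b : ℕ) = (n + 1 - w) + jp := ⟨(b : ℕ) - (n + 1 - w), by omega⟩
            have hY : UD n w u a - UD n w u ((rot n w b : Fin (n + 1)) : ℕ) = (gG n * thD n w u * ((((n + 1 - w) + (jp)) : ℕ) : ℤ) + SUB2 n w u jp) - (gG n * thD n w u * ((((n + 1 - w) + ((n + 1 - w) + jp)) : ℕ) : ℤ) + SUB2 n w u ((n + 1 - w) + jp)) := by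
              rw [hrow, hUr', hjp, muD_lt n (by omega)]; unfold UD; rw [show n + 1 - w + jp - (n + 1 - w) = jp by omega, muD_lt n (by omega)]
            have hF := D_dg0_B_lele n w u jp (n + 1 - w) (by omega) (by omega) (by omega) (by omega) (by omega)
            rw [hjp] at hT2
            exact slack_of hF hX0 hT2 hY
          · by_cases hb0 : (b : ℕ) = 0
            · have hY : UD n w u a - UD n w u ((rot n w b : Fin (n + 1)) : ℕ) = (gG n * thD n w u * (((0) : ℕ) : ℤ) + SUB2 n w u (0)) - (gG n * thD n w u * (((n + 1 - w + (0)) : ℕ) : ℤ) + SUB2 n w u (0)) := by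
                rw [hrow, hUr', hb0, muD_lt n (Nat.pos_of_ne_zero hu0)]; unfold UD; rw [Nat.zero_sub, muD_lt n (Nat.pos_of_ne_zero hu0)]
              rw [hb0] at hT2
              exact slack_of (D_dg0_P_le0 n w u (by omega) (by omega) hwn) hX0 hT2 hY
            · have hY : UD n w u a - UD n w u ((rot n w b : Fin (n + 1)) : ℕ) = gG n * thD n w u * (((b : ℕ) : ℕ) : ℤ) - (gG n * thD n w u * (((n + 1 - w + (b : ℕ)) : ℕ) : ℤ) + SUB2 n w u b) := by
                rw [hrow, hUr', muD_lt n hbu]; unfold UD; rw [show (b : ℕ) - (n + 1 - w) = 0 by omega, muD_zero]; ring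
              exact slack_of (D_dg0_P_le n w u b (by omega) (by omega) (by omega) (by omega)) hX0 hT2 hY
        · rw [if_neg hbu]
          rcases Nat.eq_or_lt_of_le (Nat.le_of_not_lt hbu) with hbu | hbu
          · -- b = u
            rcases Nat.lt_or_ge (n + 1 - w) (b : ℕ) with hblk | hpl
            · obtain ⟨jp, hjp⟩ : ∃ jp, (b : ℕ) = (n + 1 - w) + jp := ⟨(b : ℕ) - (n + 1 - w), by omega⟩
              have hu' : u = (n + 1 - w) + jp := by omega
              subst hu'
              have hY : UD n w ((n + 1 - w) + jp) a - UD n w ((n + 1 - w) + jp) ((rot n w b : Fin (n + 1)) : ℕ) = (gG n * thD n w ((n + 1 - w) + jp) * ((((n + 1 - w) + (jp)) : ℕ) : ℤ) + SUB2 n w ((n + 1 - w) + jp) jp) - (gG n * thD n w ((n + 1 - w) + jp) * ((((n + 1 - w) + (((n + 1 - w) + jp))) : ℕ) : ℤ) + SUBu n w ((n + 1 - w) + jp)) := by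
                rw [hrow, hUr', hjp, muD_ge n hu0 (lt_irrefl _), SLB_self]; unfold UD; rw [show n + 1 - w + jp - (n + 1 - w) = jp by omega, muD_lt n (by omega)]; ring
              have hF := D_dg0_B_leu n w jp (n + 1 - w) (by omega) (by omega) (by omega) (by omega)
              rw [hjp] at hT1
              exact slack_of hF hX0 hT1 hY
            · have hY : UD n w u a - UD n w u ((rot n w b : Fin (n + 1)) : ℕ) = gG n * thD n w u * (((u) : ℕ) : ℤ) - (gG n * thD n w u * (((n + 1 - w + (u)) : ℕ) : ℤ) + SUBu n w u) := by
                rw [hrow, hUr', ← hbu, muD_ge n hu0 (lt_irrefl _), SLB_self]; unfold UD; rw [show u - (n + 1 - w) = 0 by omega, muD_zero]; ring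
              rw [← hbu] at hT1
              exact slack_of (D_dg0_P_u n w u (by omega) (by omega) (by omega)) hX0 hT1 hY
          · -- b > u
            rcases Nat.lt_or_ge (n + 1 - w) (b : ℕ) with hblk | hpl
            · obtain ⟨jp, hjp⟩ : ∃ jp, (b : ℕ) = (n + 1 - w) + jp := ⟨(b : ℕ) - (n + 1 - w), by omega⟩
              rcases Nat.lt_trichotomy jp u with hju | hju | hju
              · have hY : UD n w u a - UD n w u ((rot n w b : Fin (n + 1)) : ℕ) = (gG n * thD n w u * ((((n + 1 - w) + (jp)) : ℕ) : ℤ) + SUB2 n w u jp) - (gG n * thD n w u * ((((n + 1 - w) + ((n + 1 - w) + jp)) : ℕ) : ℤ) + (SUBu n w u + SLB n w u ((n + 1 - w) + jp))) := by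
                  rw [hrow, hUr', hjp, muD_ge n hu0 (by omega)]; unfold UD; rw [show n + 1 - w + jp - (n + 1 - w) = jp by omega, muD_lt n hju]
                have hF := D_dg0_B_legt n w u jp (n + 1 - w) (by omega) (by omega) (by omega) (by omega) (by omega)
                rw [hjp] at hT1
                exact slack_of hF hX0 hT1 hY
              · rw [hju] at hjp
                have hY : UD n w u a - UD n w u ((rot n w b : Fin (n + 1)) : ℕ) = (gG n * thD n w u * ((((n + 1 - w) + (u)) : ℕ) : ℤ) + SUBu n w u) - (gG n * thD n w u * ((((n + 1 - w) + ((n + 1 - w) + u)) : ℕ) : ℤ) + (SUBu n w u + SLB n w u ((n + 1 - w) + u))) := by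
                  rw [hrow, hUr', hjp, muD_ge n hu0 (by omega)]; unfold UD; rw [show n + 1 - w + u - (n + 1 - w) = u by omega, muD_ge n hu0 (lt_irrefl _), SLB_self]; ring
                have hF := D_dg0_B_ugt n w u (n + 1 - w) (by omega) (by omega) (by omega) (by omega)
                rw [hjp] at hT1
                exact slack_of hF hX0 hT1 hY
              · have hY : UD n w u a - UD n w u ((rot n w b : Fin (n + 1)) : ℕ) = (gG n * thD n w u * ((((n + 1 - w) + (jp)) : ℕ) : ℤ) + (SUBu n w u + SLB n w u jp)) - (gG n * thD n w u * ((((n + 1 - w) + ((n + 1 - w) + jp)) : ℕ) : ℤ) + (SUBu n w u + SLB n w u ((n + 1 - w) + jp))) := by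
                  rw [hrow, hUr', hjp, muD_ge n hu0 (by omega)]; unfold UD; rw [show n + 1 - w + jp - (n + 1 - w) = jp by omega, muD_ge n hu0 (by omega)]
                have hF := D_dg0_B_gtgt n w u jp (n + 1 - w) (by omega) (by omega) (by omega) (by omega) (by omega)
                rw [hjp] at hT1
                exact slack_of hF hX0 hT1 hY
            · have hY : UD n w u a - UD n w u ((rot n w b : Fin (n + 1)) : ℕ) = gG n * thD n w u * (((b : ℕ) : ℕ) : ℤ) - (gG n * thD n w u * (((n + 1 - w + (b : ℕ)) : ℕ) : ℤ) + (SUBu n w u + SLB n w u b)) := by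
                rw [hrow, hUr', muD_ge n hu0 (by omega)]; unfold UD; rw [show (b : ℕ) - (n + 1 - w) = 0 by omega, muD_zero]; ring
              exact slack_of (D_dg0_P_gt n w u b (by omega) (by omega) (by omega) (by omega)) hX0 hT1 hY
    · have hXl : thD n w u * (dd n l : ℤ) - vv n a b l + 1 ≤ thD n w u * d1 n - v1 n (n + 1) b + 1 ∨ l = 1 := by
        rcases (show l = 0 ∨ l = 1 ∨ l = 2 ∨ l = 3 by fin_cases l <;> simp) with rfl | rfl | rfl | rfl
        · exact absurd rfl hcl
        · exact Or.inr rfl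
        · left; rw [dd_cast_two, vv_diag n hab' 2 (by decide), vblk_two]
          linarith [D_fut2_m n w u b (by omega) hwn]
        · left; rw [dd_cast_three, vv_diag n hab' 3 (by decide), vblk_three]
          linarith [D_fut3_m n w u b (by omega) hwn]
      have hXl : thD n w u * (dd n l : ℤ) - vv n a b l ≤ thD n w u * d1 n - v1 n (n + 1) b := by
        rcases hXl with h | rfl
        · linarith
        · exact le_of_eq hX1
      clear hX1
      -- now the regimes (level m families); we package X via hXl: use slack_of with X' := X and hF' := from family + hXl
      by_cases hu0 : u = 0
      · subst hu0
        rw [if_neg (Nat.not_lt_zero _)]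
        rcases Nat.lt_or_ge (b : ℕ) k with hkb | hkb
        · have hY : UD n w 0 a - UD n w 0 ((rot n w b : Fin (n + 1)) : ℕ) = gG n * thD n w 0 * (((n + 1 - w + b - k) : ℕ) : ℤ) - (gG n * thD n w 0 * (((n + 1 - w + (b : ℕ)) : ℕ) : ℤ) + SLB0 n w b) := by
            rw [hUr', muD_z]; unfold UD; rw [show (a : ℕ) - (n + 1 - w) = 0 by omega, muD_zero, show (a : ℕ) = n + 1 - w + (b : ℕ) - k by omega]; ring
          have hF := D_up_PZ_m n w b k (by omega) (by omega) (by omega)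
          exact slack_le hF hXl hT1 hY
        · have hY : UD n w 0 a - UD n w 0 ((rot n w b : Fin (n + 1)) : ℕ) = (-(gG n * thD n w 0 * ((k : ℕ) : ℤ))) + (SLB0 n w (b - k) - SLB0 n w b) := by
            rw [hUr, muD_z]; unfold UD; rw [show (a : ℕ) - (n + 1 - w) = (b : ℕ) - k by omega, muD_z, hak]
            push_cast [Nat.cast_sub hkle, Nat.cast_sub hw1]; ring
          have hF := D_up_Z_m n w b k hk1 (by omega) (by omega) (by omega)
          exact slack_le hF hXl hT1 hY
      · by_cases hbu : (b : ℕ) < u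
        · rw [if_pos hbu]
          by_cases hb0 : (b : ℕ) = 0
          · have hY : UD n w u a - UD n w u ((rot n w b : Fin (n + 1)) : ℕ) = gG n * thD n w u * (((n + 1 - w - k) : ℕ) : ℤ) - gG n * thD n w u * (((n + 1 - w) : ℕ) : ℤ) := by
              rw [hUr', hb0, muD_zero]; unfold UD; rw [show (a : ℕ) - (n + 1 - w) = 0 by omega, muD_zero, show (a : ℕ) = n + 1 - w - k by omega, Nat.add_zero]; ring
            have hF := D_up_PA0_m n w u k hk1 (by omega) (by omega) (by omega)
            rw [hb0] at hXl hT2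
            exact slack_le hF hXl hT2 hY
          · rcases Nat.lt_or_ge (b : ℕ) k with hkb | hkb
            · have hY : UD n w u a - UD n w u ((rot n w b : Fin (n + 1)) : ℕ) = gG n * thD n w u * (((n + 1 - w + b - k) : ℕ) : ℤ) - (gG n * thD n w u * (((n + 1 - w + (b : ℕ)) : ℕ) : ℤ) + SUB2 n w u b) := by
                rw [hUr', muD_lt n hbu]; unfold UD; rw [show (a : ℕ) - (n + 1 - w) = 0 by omega, muD_zero, show (a : ℕ) = n + 1 - w + (b : ℕ) - k by omega]; ring
              have hF := D_up_PA_m n w u b k (by omega) (by omega) (by omega) (by omega) (by omega)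
              exact slack_le hF hXl hT2 hY
            · have hY : UD n w u a - UD n w u ((rot n w b : Fin (n + 1)) : ℕ) = (-(gG n * thD n w u * ((k : ℕ) : ℤ))) + (SUB2 n w u (b - k) - SUB2 n w u b) := by
                rw [hUr, muD_lt n hbu]; unfold UD; rw [show (a : ℕ) - (n + 1 - w) = (b : ℕ) - k by omega, muD_lt n (by omega), hak]
                push_cast [Nat.cast_sub hkle, Nat.cast_sub hw1]; ring
              have hF := D_up_A_m n w u b k hk1 (by omega) (by omega) (by omega) (by omega)
              exact slack_le hF hXl hT2 hY
        · rw [if_neg hbu]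
          rcases Nat.eq_or_lt_of_le (Nat.le_of_not_lt hbu) with hbu | hbu
          · rcases Nat.lt_or_ge u k with hku | hku
            · have hY : UD n w u a - UD n w u ((rot n w b : Fin (n + 1)) : ℕ) = gG n * thD n w u * (((n + 1 - w + u - k) : ℕ) : ℤ) - (gG n * thD n w u * (((n + 1 - w + (u)) : ℕ) : ℤ) + SUBu n w u) := by
                rw [hUr', ← hbu, muD_ge n hu0 (lt_irrefl _), SLB_self]; unfold UD; rw [show (a : ℕ) - (n + 1 - w) = 0 by omega, muD_zero, show (a : ℕ) = n + 1 - w + u - k by omega]; ring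
              have hF := D_up_PB_m n w u k (by omega) (by omega) (by omega) (by omega)
              rw [← hbu] at hXl hT1
              exact slack_le hF hXl hT1 hY
            · have hY : UD n w u a - UD n w u ((rot n w b : Fin (n + 1)) : ℕ) = (-(gG n * thD n w u * ((k : ℕ) : ℤ))) + (SUB2 n w u (u - k) - SUBu n w u) := by
                rw [hUr, ← hbu, muD_ge n hu0 (lt_irrefl _), SLB_self]; unfold UD; rw [show (a : ℕ) - (n + 1 - w) = u - k by omega, muD_lt n (by omega), hak, ← hbu]
                push_cast [Nat.cast_sub (show k ≤ u + (n + 1 - w) by omega), Nat.cast_sub hw1]; ring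
              have hF := D_up_Bq_m n w u k hk1 (by omega) (by omega) (by omega)
              rw [← hbu] at hXl hT1
              exact slack_le hF hXl hT1 hY
          · rcases Nat.lt_or_ge (b : ℕ) (k + 1) with hkb | hkb
            · have hY : UD n w u a - UD n w u ((rot n w b : Fin (n + 1)) : ℕ) = gG n * thD n w u * (((n + 1 - w + b - k) : ℕ) : ℤ) - (gG n * thD n w u * (((n + 1 - w + (b : ℕ)) : ℕ) : ℤ) + (SUBu n w u + SLB n w u b)) := by
                rw [hUr', muD_ge n hu0 (by omega)]; unfold UD; rw [show (a : ℕ) - (n + 1 - w) = 0 by omega, muD_zero, show (a : ℕ) = n + 1 - w + (b : ℕ) - k by omega]; ring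
              have hF := D_up_PC_m n w u b k (by omega) (by omega) (by omega) (by omega) (by omega)
              exact slack_le hF hXl hT1 hY
            · rcases Nat.lt_trichotomy ((b : ℕ) - k) u with hsu | hsu | hsu
              · obtain ⟨s, hs⟩ : ∃ s, s + k = (b : ℕ) := ⟨(b : ℕ) - k, by omega⟩
                have hY : UD n w u a - UD n w u ((rot n w b : Fin (n + 1)) : ℕ) = (-(gG n * thD n w u * (((b - s) : ℕ) : ℤ))) + (SUB2 n w u s - (SUBu n w u + SLB n w u b)) := by
                  rw [hUr, muD_ge n hu0 (by omega)]; unfold UD; rw [show (a : ℕ) - (n + 1 - w) = s by omega, muD_lt n (by omega), hak, show (b : ℕ) - s = k by omega]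
                  push_cast [Nat.cast_sub hkle, Nat.cast_sub hw1]; ring
                have hF := D_up_C_m n w u b s (by omega) (by omega) (by omega) (by omega)
                exact slack_le hF hXl hT1 hY
              · have hY : UD n w u a - UD n w u ((rot n w b : Fin (n + 1)) : ℕ) = (-(gG n * thD n w u * (((b - u) : ℕ) : ℤ))) + (SUBu n w u - (SUBu n w u + SLB n w u b)) := by
                  rw [hUr, muD_ge n hu0 (by omega)]; unfold UD; rw [show (a : ℕ) - (n + 1 - w) = u by omega, muD_ge n hu0 (lt_irrefl _), SLB_self, hak, show (b : ℕ) - u = k by omega]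
                  push_cast [Nat.cast_sub hkle, Nat.cast_sub hw1]; ring
                have hF := D_up_Dq_m n w u b (by omega) (by omega) (by omega) (by omega)
                exact slack_le hF hXl hT1 hY
              · have hY : UD n w u a - UD n w u ((rot n w b : Fin (n + 1)) : ℕ) = (-(gG n * thD n w u * ((k : ℕ) : ℤ))) + ((SUBu n w u + SLB n w u (b - k)) - (SUBu n w u + SLB n w u b)) := by
                  rw [hUr, muD_ge n hu0 (by omega)]; unfold UD; rw [show (a : ℕ) - (n + 1 - w) = (b : ℕ) - k by omega, muD_ge n hu0 (by omega), hak]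
                  push_cast [Nat.cast_sub hkle, Nat.cast_sub hw1]; ring
                have hF := D_up_Ee_m n w u b k (by omega) hk1 (by omega) (by omega) (by omega)
                exact slack_le hF hXl hT1 hY
  · -- strictly below the diagonal: level w + k < m
    have hEa : n + 1 + (b : ℕ) - (a : ℕ) = w + k := by omega
    have hkn : k + w ≤ n := by omega
    have hne1 : w + k ≠ n + 1 := by omega
    have hX1 : thD n w u * (dd n 1 : ℤ) - vv n a b 1 = thD n w u * d1 n - v1 n (w + k) b := by
      rw [dd_cast_one, vv_lower n hab, hEa, vblk_one]
    have hcl : l ≠ 0 := fun h0 => by subst h0; exact hp (ee_lower_zero n hab)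
    have hXl : thD n w u * (dd n l : ℤ) - vv n a b l + 1 ≤ thD n w u * d1 n - v1 n (w + k) b + 1 ∨ l = 1 := by
      rcases (show l = 0 ∨ l = 1 ∨ l = 2 ∨ l = 3 by fin_cases l <;> simp) with rfl | rfl | rfl | rfl
      · exact absurd rfl hcl
      · exact Or.inr rfl
      · left; rw [dd_cast_two, vv_lower n hab, hEa, vblk_two, tau2_of_ne n hne1]
        linarith [D_fut2_lt1 n w u b (w + k) (by omega) (by omega) (by omega)]
      · left; rw [dd_cast_three, vv_lower n hab, hEa, vblk_three, tau2_of_ne n hne1, tau3_of_ne n hne1]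
        linarith [D_fut3_lt1 n w u b (w + k) (by omega) (by omega) (by omega)]
    have hXl : thD n w u * (dd n l : ℤ) - vv n a b l ≤ thD n w u * d1 n - v1 n (w + k) b := by
      rcases hXl with h | rfl
      · linarith
      · exact le_of_eq hX1
    clear hX1
    by_cases hu0 : u = 0
    · subst hu0
      rw [if_neg (Nat.not_lt_zero _)]
      rcases Nat.lt_or_ge (b : ℕ) k with hkb | hkb
      · have hY : UD n w 0 a - UD n w 0 ((rot n w b : Fin (n + 1)) : ℕ) = gG n * thD n w 0 * (((n + 1 - w + b - k) : ℕ) : ℤ) - (gG n * thD n w 0 * (((n + 1 - w + (b : ℕ)) : ℕ) : ℤ) + SLB0 n w b) := by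
          rw [hUr', muD_z]; unfold UD; rw [show (a : ℕ) - (n + 1 - w) = 0 by omega, muD_zero, show (a : ℕ) = n + 1 - w + (b : ℕ) - k by omega]; ring
        have hF := D_up_PZ_lt n w b k (by omega) (by omega) (by omega)
        exact slack_le hF hXl hT1 hY
      · have hY : UD n w 0 a - UD n w 0 ((rot n w b : Fin (n + 1)) : ℕ) = (-(gG n * thD n w 0 * ((k : ℕ) : ℤ))) + (SLB0 n w (b - k) - SLB0 n w b) := by
          rw [hUr, muD_z]; unfold UD; rw [show (a : ℕ) - (n + 1 - w) = (b : ℕ) - k by omega, muD_z, hak]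
          push_cast [Nat.cast_sub hkle, Nat.cast_sub hw1]; ring
        have hF := D_up_Z_lt n w b k hk1 (by omega) (by omega) (by omega)
        exact slack_le hF hXl hT1 hY
    · by_cases hbu : (b : ℕ) < u
      · rw [if_pos hbu]
        by_cases hb0 : (b : ℕ) = 0
        · have hY : UD n w u a - UD n w u ((rot n w b : Fin (n + 1)) : ℕ) = gG n * thD n w u * (((n + 1 - w - k) : ℕ) : ℤ) - gG n * thD n w u * (((n + 1 - w) : ℕ) : ℤ) := by
            rw [hUr', hb0, muD_zero]; unfold UD; rw [show (a : ℕ) - (n + 1 - w) = 0 by omega, muD_zero, show (a : ℕ) = n + 1 - w - k by omega, Nat.add_zero]; ring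
          have hF := D_up_PA0_lt n w u k hk1 (by omega) (by omega) (by omega)
          rw [hb0] at hXl hT2
          exact slack_le hF hXl hT2 hY
        · rcases Nat.lt_or_ge (b : ℕ) k with hkb | hkb
          · have hY : UD n w u a - UD n w u ((rot n w b : Fin (n + 1)) : ℕ) = gG n * thD n w u * (((n + 1 - w + b - k) : ℕ) : ℤ) - (gG n * thD n w u * (((n + 1 - w + (b : ℕ)) : ℕ) : ℤ) + SUB2 n w u b) := by
              rw [hUr', muD_lt n hbu]; unfold UD; rw [show (a : ℕ) - (n + 1 - w) = 0 by omega, muD_zero, show (a : ℕ) = n + 1 - w + (b : ℕ) - k by omega]; ring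
            have hF := D_up_PA_lt n w u b k (by omega) (by omega) (by omega) (by omega) (by omega)
            exact slack_le hF hXl hT2 hY
          · have hY : UD n w u a - UD n w u ((rot n w b : Fin (n + 1)) : ℕ) = (-(gG n * thD n w u * ((k : ℕ) : ℤ))) + (SUB2 n w u (b - k) - SUB2 n w u b) := by
              rw [hUr, muD_lt n hbu]; unfold UD; rw [show (a : ℕ) - (n + 1 - w) = (b : ℕ) - k by omega, muD_lt n (by omega), hak]
              push_cast [Nat.cast_sub hkle, Nat.cast_sub hw1]; ring
            have hF := D_up_A_lt n w u b k hk1 (by omega) (by omega) (by omega) (by omega)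
            exact slack_le hF hXl hT2 hY
      · rw [if_neg hbu]
        rcases Nat.eq_or_lt_of_le (Nat.le_of_not_lt hbu) with hbu | hbu
        · rcases Nat.lt_or_ge u k with hku | hku
          · have hY : UD n w u a - UD n w u ((rot n w b : Fin (n + 1)) : ℕ) = gG n * thD n w u * (((n + 1 - w + u - k) : ℕ) : ℤ) - (gG n * thD n w u * (((n + 1 - w + (u)) : ℕ) : ℤ) + SUBu n w u) := by
              rw [hUr', ← hbu, muD_ge n hu0 (lt_irrefl _), SLB_self]; unfold UD; rw [show (a : ℕ) - (n + 1 - w) = 0 by omega, muD_zero, show (a : ℕ) = n + 1 - w + u - k by omega]; ring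
            have hF := D_up_PB_lt n w u k (by omega) (by omega) (by omega) (by omega)
            rw [← hbu] at hXl hT1
            exact slack_le hF hXl hT1 hY
          · have hY : UD n w u a - UD n w u ((rot n w b : Fin (n + 1)) : ℕ) = (-(gG n * thD n w u * ((k : ℕ) : ℤ))) + (SUB2 n w u (u - k) - SUBu n w u) := by
              rw [hUr, ← hbu, muD_ge n hu0 (lt_irrefl _), SLB_self]; unfold UD; rw [show (a : ℕ) - (n + 1 - w) = u - k by omega, muD_lt n (by omega), hak, ← hbu]
              push_cast [Nat.cast_sub (show k ≤ u + (n + 1 - w) by omega), Nat.cast_sub hw1]; ring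
            have hF := D_up_Bq_lt n w u k hk1 (by omega) (by omega) (by omega)
            rw [← hbu] at hXl hT1
            exact slack_le hF hXl hT1 hY
        · rcases Nat.lt_or_ge (b : ℕ) (k + 1) with hkb | hkb
          · have hY : UD n w u a - UD n w u ((rot n w b : Fin (n + 1)) : ℕ) = gG n * thD n w u * (((n + 1 - w + b - k) : ℕ) : ℤ) - (gG n * thD n w u * (((n + 1 - w + (b : ℕ)) : ℕ) : ℤ) + (SUBu n w u + SLB n w u b)) := by
              rw [hUr', muD_ge n hu0 (by omega)]; unfold UD; rw [show (a : ℕ) - (n + 1 - w) = 0 by omega, muD_zero, show (a : ℕ) = n + 1 - w + (b : ℕ) - k by omega]; ring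
            have hF := D_up_PC_lt n w u b k (by omega) (by omega) (by omega) (by omega) (by omega)
            exact slack_le hF hXl hT1 hY
          · rcases Nat.lt_trichotomy ((b : ℕ) - k) u with hsu | hsu | hsu
            · obtain ⟨s, hs⟩ : ∃ s, s + k = (b : ℕ) := ⟨(b : ℕ) - k, by omega⟩
              have hY : UD n w u a - UD n w u ((rot n w b : Fin (n + 1)) : ℕ) = (-(gG n * thD n w u * (((b - s) : ℕ) : ℤ))) + (SUB2 n w u s - (SUBu n w u + SLB n w u b)) := by
                rw [hUr, muD_ge n hu0 (by omega)]; unfold UD; rw [show (a : ℕ) - (n + 1 - w) = s by omega, muD_lt n (by omega), hak, show (b : ℕ) - s = k by omega]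
                push_cast [Nat.cast_sub hkle, Nat.cast_sub hw1]; ring
              rw [show w + k = w + ((b : ℕ) - s) by omega] at hXl
              have hF := D_up_C_lt n w u b s (by omega) (by omega) (by omega) (by omega)
              exact slack_le hF hXl hT1 hY
            · have hY : UD n w u a - UD n w u ((rot n w b : Fin (n + 1)) : ℕ) = (-(gG n * thD n w u * (((b - u) : ℕ) : ℤ))) + (SUBu n w u - (SUBu n w u + SLB n w u b)) := by
                rw [hUr, muD_ge n hu0 (by omega)]; unfold UD; rw [show (a : ℕ) - (n + 1 - w) = u by omega, muD_ge n hu0 (lt_irrefl _), SLB_self, hak, show (b : ℕ) - u = k by omega]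
                push_cast [Nat.cast_sub hkle, Nat.cast_sub hw1]; ring
              rw [show w + k = w + ((b : ℕ) - u) by omega] at hXl
              have hF := D_up_Dq_lt n w u b (by omega) (by omega) (by omega) (by omega)
              exact slack_le hF hXl hT1 hY
            · have hY : UD n w u a - UD n w u ((rot n w b : Fin (n + 1)) : ℕ) = (-(gG n * thD n w u * ((k : ℕ) : ℤ))) + ((SUBu n w u + SLB n w u (b - k)) - (SUBu n w u + SLB n w u b)) := by
                rw [hUr, muD_ge n hu0 (by omega)]; unfold UD; rw [show (a : ℕ) - (n + 1 - w) = (b : ℕ) - k by omega, muD_ge n hu0 (by omega), hak]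
                push_cast [Nat.cast_sub hkle, Nat.cast_sub hw1]; ring
              have hF := D_up_Ee_lt n w u b k (by omega) hk1 (by omega) (by omega) (by omega)
              exact slack_le hF hXl hT1 hY

end GradedWalk

end Summit.ValiantsHypothesis.ValiantsHypothesis.Theorems.LacunarySymmetroidMatrixDescartes.TropicalCensus
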